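import Literature.MathematicalPhysics.QuantumFieldTheory.Balaban1983to89.B6Prop22SixMultiLevelBoxRateUnif

/-!
# `Balaban1983to89.B6Prop22SeriesMultiLevelBox` — [B6] PROPOSITION 2.2, THE CONVERGENCE CLAUSE «The random walk
representation (2.50) is convergent in the norms defined by these inequalities», FOR THE GENUINE `k`-LEVEL OPERATOR
`G′ = Δ′_a^{−1}` ON A BOX — QUANTITATIVE FORM: the remainders `G′R^N = G′ − G′₀Σ_{n<N}Rⁿ` of (2.50) decay like `2^{−N}`
in the majorant norms of the first, second and fourth entries of (2.67) (no existing module is touched; no fact is minted)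

FRAMING (verbatim cell line):
statement-level skeleton of published theorems with citation tags; proofs where landed; nothing here is a claim about the Yang–Mills mass gap

Source under audit (cell pub-balaban / lit-balaban): T. Bałaban, *Propagators and renormalization transformations for
lattice gauge theories. II*, Commun. Math. Phys. **96** (1984) 223–250 [`Balaban1984PropagatorsII`, "B6"], p. 234
[PDF 12] (2.64)–(2.67), Proposition 2.2; p. 232 [PDF 10] (2.50)–(2.55) (renders
`run/shared/lean/pub/pub-balaban/b2b-balaban-ref1/pages/1984-cmp96-propagators-rt-II/…-p010/p012-x2.png`); [3] =
T. Bałaban, *Regularity and decay of lattice Green's functions*, Commun. Math. Phys. **89** (1983) 571–597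
[`Balaban1983RegularityDecay`], Theorem (1.9) p. 573.  PDF held: `paper:balaban1984-cmp96-propagators-rt-ii` (journal
page = PDF page + 222).  Unit `lit-balaban-p21` (Phase-2 proof seat p21 gen 12), HOME `run/shared/lean/pub/lit-balaban/`,
B6 fold owner r03 (rows **B6.Prop2.2**, **B6.Eq2.50**), referee ref-4.

## WHAT IS PRINTED (pp. 232, 234, verbatim up to notation)

p. 232: «G′ = G′₀(I − R)^{−1} = G′₀ Σ_{n=0}^∞ Rⁿ. (2.50)»; p. 234: «… |(G′λ)(x)| ≤ Σ_{n=0}^∞ |(G′₀Rⁿλ)(x)| ≤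
O(1)(L^jη)² e^{−½δ₀d(y,y′)}|λ|. (2.66) … **Proposition 2.2.** If we have (2.1), (2.2) and M is sufficiently large, then
the operator G′ = Δ′_a^{−1} (a = 1) satisfies the inequalities … (2.67)  The random walk representation (2.50) is
convergent in the norms defined by these inequalities.»

## WHAT THIS FILE CERTIFIES (kernel-checked)

* §1 `majorant_remainder_266W` — THE TAIL OF (2.66), generic: for any `G′ = G₀ + G′R` on a finite lattice with majorants
  `A·P(y)e^{−δ₀d}` of `G₀` and `θe^{−δ₀d}` of `R`, (2.61)/(2.63) with a constant `c` and `θc < 1`, the remainder `G′R^N`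
  has majorant `A c (θc)^N (1 − θc)^{−1} P(y) e^{−(1−α)δ₀d(y,y′)}` for every `N` (the proof of
  `B6Prop23Chain.majorant_of_fixedPoint_266W` run on the fixed point `G′R^N = G₀R^N + (G′R^N)R`: partial sums (2.65)–(2.66)
  from `N` on, the far remainder killed by the operator bound); `partialSum_add_remainder` — the algebra
  `G′ = G₀Σ_{n<N}Rⁿ + G′R^N`.
* §2 THE GENUINE `k`-LEVEL OPERATOR (`gml`, `gZeroML`, `rML` of files 1–5): `prop22_series_first_multiLevelBox` — there are
  `δ₀, C, M₀ > 0`, `N₀ ≥ 1` with, for every `k`, `M_h ≥ 3`, `L·M_h ≥ M₀`, `R ≥ 2L`, `RM ≥ N₀ + 1`, volume, nested family `D`,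
  weights in the windows (`a_{i+1} = aNext ℓ a_i c_i`) and EVERY `N`: the remainder `G′R^N` has majorant
  `C·2^{−N}·L^{2j}·e^{−½δ₀d(y,y′)}` on the blocks AND `G′` itself the majorant `C·L^{2j}·e^{−½δ₀d(y,y′)}` (the first entry,
  same constants); `prop22_series_second_multiLevelBox` — the same for `∇_μG′` (`∇_μG′R^N`: `C·2^{−N}·L^{j}`);
  `gml_eq_partialSum_add_remainder` — `G′ = G′₀Σ_{n<N}Rⁿ + G′R^N` as matrices, so the two theorems say: the partial sums of
  (2.50) converge to `G′` geometrically in the norms of the first two entries of (2.67).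
* §3 `prop22_series_fourth_multiLevelBox_unif` — the same for the lifted Hölder functional of the fourth entry, in print's
  quantifier order (`∃ δ₀ M₀ N₀ ∀ α ∈ [0,1) ∃ C(α)`): the pair functional of `∇_μ(G′R^N)` over the pairs of one block has
  majorant `C(α)·2^{−N}·(L^{j})^{1−α}·e^{−½δ₀d}` (`liftL T(G′) · (liftR R)^N = liftL T(G′R^N)`).

## HONEST SCOPE

Entries 1, 2, 4 of (2.67) only (the right fixed points `T = T₀ + T·R` of files 5, 6, 11); the third, fifth and sixth
entries (transposed/conjugated fixed points, files 9, 13, 7) are NOT treated here.  Otherwise as files 1–14 of the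
lineage: levels `1 … k` on a Neumann box, `m² = 0`, the asymmetric partition, `M_h ≥ 3`, `R ≥ 2L`, lattice units
(`L^{2j}`, `L^{j}`, `(L^{j})^{1−α}` for «(L^jη)²», «L^jη», «(L^jη)^{1−α}»), `L`-dependent (2.61)-constant, «M sufficiently
large» `= 2Kc + 1` so that `θc ≤ ½` (whence the ratio `½`), constants existential.  Nothing is inferred from the
manuscript: every step is kernel-checked.  NOT summit progress.
-/

namespace Literature.MathematicalPhysics.QuantumFieldTheory.Balaban1983to89.B6Prop22SeriesMultiLevelBox

open Matrix
open Literature.MathematicalPhysics.QuantumFieldTheory.Balaban1983to89.B4Reflection242 (boxDom)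
open Literature.MathematicalPhysics.QuantumFieldTheory.Balaban1983to89.B4ContourShift (supNorm supNorm_nonneg)
open Literature.MathematicalPhysics.QuantumFieldTheory.Balaban1983to89.B6Ineq243TwoLevelBox (aNext)
open Literature.MathematicalPhysics.QuantumFieldTheory.Balaban1983to89.B6MultiLevelBoxOperator
open Literature.MathematicalPhysics.QuantumFieldTheory.Balaban1983to89.B6Eq238MultiLevelBox
open Literature.MathematicalPhysics.QuantumFieldTheory.Balaban1983to89.B6Ineq249MultiLevelBox
open Literature.MathematicalPhysics.QuantumFieldTheory.Balaban1983to89.B6Geom246MultiLevelBox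
open Literature.MathematicalPhysics.QuantumFieldTheory.Balaban1983to89.B6Prop22MultiLevelBox
open Literature.MathematicalPhysics.QuantumFieldTheory.Balaban1983to89.B6Prop22DerivMultiLevelBox (dMat
  dMat_gZeroML_majorant fixedPoint_dMat_gml)
open Literature.MathematicalPhysics.QuantumFieldTheory.Balaban1983to89.B6Prop22HolderMultiLevelBox (liftL liftR HPair blkP
  holderOp holderOp_apply holderOp_mul liftL_mul_liftR fixedPoint_holder hasMajorant_liftL hasMajorant_liftR
  rowBound_of_hasMajorant_liftL)
open Literature.MathematicalPhysics.QuantumFieldTheory.Balaban1983to89.B6Prop22HolderMultiLevelBoxRateUnif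
  (holderZero_rowBound_unif)
open Literature.MathematicalPhysics.QuantumFieldTheory.Balaban1983to89.B6RandomWalk (HasMajorant BlockSupp
  hasMajorant_mono hasMajorant_add hasMajorant_sum hasMajorant_mul Triangle254 exists_opBound fixedPoint_telescope)
open Literature.MathematicalPhysics.QuantumFieldTheory.Balaban1983to89.B6Lemma21Repaired (Ineq261With Ineq263With)
open Literature.MathematicalPhysics.QuantumFieldTheory.Balaban1983to89.B6Ineq261LevelGap (K261 K261_nonneg
  theta_lt_one_of_log)
open Literature.MathematicalPhysics.QuantumFieldTheory.Balaban1983to89.B6Prop23Chain (majorant_pow_265W majorant_G0_mul_265W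
  majorant_of_fixedPoint_266W)

noncomputable section

variable {d : ℕ}

/-! ## §1 The tail of (2.66): the remainder `G′R^N` of the random walk representation, generic constant -/

section Generic

variable {g : B6.Geometry} {X : Type}

/-- the algebra of (2.50): `G′ = G₀Σ_{n<N}Rⁿ + G′R^N` for any `G′ = G₀ + G′R`. [cite: Balaban1984PropagatorsII, (2.50) p.232] -/
theorem partialSum_add_remainder {G' G0 R : Module.End ℝ (X → ℝ)} (hfix : G' = G0 + G' * R) (N : ℕ) :
    G' = G0 * (∑ n ∈ Finset.range N, R ^ n) + G' * R ^ N := by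
  rw [Finset.mul_sum]
  exact fixedPoint_telescope hfix N

/-- **THE TAIL OF (2.66)** (generic (2.61)-constant `c`): if `G′ = G₀ + G′R` on a finite lattice, `G₀` has majorant
`A·P(y)e^{−δ₀d(y,y′)}`, `R` has majorant `θe^{−δ₀d(y,y′)}` ((2.64)), (2.61) and (2.63) hold with constant `c` and `θc < 1`, then
for every `N` the remainder `G′R^N` of (2.50) has majorant `A c (θc)^N (1 − θc)^{−1} P(y) e^{−(1−α)δ₀d(y,y′)}`: by (2.65)
`G₀R^{N+m}` has majorant `A c P (θc)^{N+m} e^{−(1−α)δ₀d}`, the sum over `m` is the displayed geometric tail, and the far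
remainder `G′R^{N+M}` dies as `M → ∞` («Σ_{n=0}^∞ |(G′₀Rⁿλ)(x)| ≤ …»).
[cite: Balaban1984PropagatorsII, (2.65)–(2.66) p.234, Proposition 2.2 p.234 («(2.50) is convergent in the norms defined by these inequalities»)] -/
theorem majorant_remainder_266W [Fintype X] [DecidableEq X] (blk : X → g.Site) (c δ₀ α θ A : ℝ)
    (P : g.Site → ℝ) (hA : 0 ≤ A) (hP : ∀ y, 0 ≤ P y) (hθ : 0 ≤ θ) (hc : 0 ≤ c) (hαδ : 0 ≤ (1 - α) * δ₀)
    (htri : Triangle254 g) (hrefl : ∀ y : g.Site, g.dist y y = 0) (hdnn : ∀ y y' : g.Site, 0 ≤ g.dist y y')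
    (h261 : Ineq261With c g δ₀ α) (h263 : Ineq263With c g δ₀ α) (hsmall : θ * c < 1)
    {G' G0 R : Module.End ℝ (X → ℝ)}
    (hG0 : HasMajorant blk G0 (fun a b => A * P a * Real.exp (-(δ₀ * g.dist a b))))
    (hR : HasMajorant blk R (fun a b => θ * Real.exp (-(δ₀ * g.dist a b)))) (hfix : G' = G0 + G' * R) (N : ℕ) :
    HasMajorant blk (G' * R ^ N)
      (fun a b => A * c * (θ * c) ^ N * (1 - θ * c)⁻¹ * P a * Real.exp (-((1 - α) * δ₀ * g.dist a b))) := by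
  intro y' μ B hμ x
  obtain ⟨E, hE, hEb⟩ := exists_opBound G'
  set q : ℝ := θ * c with hq
  have hq0 : 0 ≤ q := mul_nonneg hθ hc
  have hq1 : 0 < 1 - q := by linarith
  -- the remainder is itself a fixed point: `G′R^N = G₀R^N + (G′R^N)R`
  have hfix' : G' * R ^ N = G0 * R ^ N + (G' * R ^ N) * R := by
    conv_lhs => rw [hfix]
    rw [add_mul, mul_assoc, mul_assoc, ← pow_succ', ← pow_succ]
  set C : ℝ := A * c * q ^ N * (1 - q)⁻¹ * P (blk x) * Real.exp (-((1 - α) * δ₀ * g.dist (blk x) y')) * B with hC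
  have hM : ∀ M : ℕ, |(G' * R ^ N) μ x| ≤ C + E * B * q ^ (N + M) := by
    intro M
    -- the terms `G₀R^{N+m}` and their sum over `m < M`
    have hterm : ∀ m, HasMajorant blk (G0 * R ^ N * R ^ m)
        (fun a b => A * c * P a * q ^ (N + m) * Real.exp (-((1 - α) * δ₀ * g.dist a b))) := by
      intro m
      rw [mul_assoc, ← pow_add]
      exact majorant_G0_mul_265W blk c δ₀ α A (q ^ (N + m)) P hA hP (pow_nonneg hq0 _) hαδ htri h261 hG0
        (majorant_pow_265W blk c δ₀ α θ hθ hrefl h263 hR (N + m))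
    have hS := hasMajorant_sum blk (fun m => G0 * R ^ N * R ^ m) _ hterm M y' μ B hμ x
    -- the far remainder `G′R^{N+M}`
    have hRN := majorant_pow_265W blk c δ₀ α θ hθ hrefl h263 hR (N + M) y' μ B hμ
    have hsup : ∀ z, |(R ^ (N + M)) μ z| ≤ q ^ (N + M) * B := fun z => by
      refine (hRN z).trans ?_
      refine mul_le_mul_of_nonneg_right ?_ hμ.nonneg
      have : Real.exp (-((1 - α) * δ₀ * g.dist (blk z) y')) ≤ 1 := by
        rw [Real.exp_le_one_iff]
        have := mul_nonneg hαδ (hdnn (blk z) y')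
        linarith
      simpa [hq] using mul_le_mul_of_nonneg_left this (pow_nonneg hq0 (N + M))
    have hrem : |(G' * R ^ N * R ^ M) μ x| ≤ E * (q ^ (N + M) * B) := by
      rw [mul_assoc, ← pow_add, Module.End.mul_apply]
      exact hEb _ _ (mul_nonneg (pow_nonneg hq0 _) hμ.nonneg) hsup x
    have hsplit : (G' * R ^ N) μ x
        = (∑ m ∈ Finset.range M, G0 * R ^ N * R ^ m) μ x + (G' * R ^ N * R ^ M) μ x := by
      conv_lhs => rw [fixedPoint_telescope hfix' M]
      rfl
    rw [hsplit]
    refine (abs_add_le _ _).trans ?_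
    -- the geometric tail
    have hgeom : ∑ m ∈ Finset.range M, q ^ (N + m) ≤ q ^ N * (1 - q)⁻¹ := by
      have h1 : ∑ m ∈ Finset.range M, q ^ m ≤ (1 - q)⁻¹ :=
        sum_le_hasSum (Finset.range M) (fun n _ => pow_nonneg hq0 n) (hasSum_geometric_of_lt_one hq0 hsmall)
      calc ∑ m ∈ Finset.range M, q ^ (N + m) = q ^ N * ∑ m ∈ Finset.range M, q ^ m := by
            rw [Finset.mul_sum]; exact Finset.sum_congr rfl fun m _ => pow_add _ _ _
        _ ≤ q ^ N * (1 - q)⁻¹ := mul_le_mul_of_nonneg_left h1 (pow_nonneg hq0 N)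
    have hK0 : 0 ≤ A * c * P (blk x) * Real.exp (-((1 - α) * δ₀ * g.dist (blk x) y')) * B :=
      mul_nonneg (mul_nonneg (mul_nonneg (mul_nonneg hA hc) (hP _)) (Real.exp_nonneg _)) hμ.nonneg
    have h1 : |(∑ m ∈ Finset.range M, G0 * R ^ N * R ^ m) μ x| ≤ C := by
      refine hS.trans ?_
      calc (∑ m ∈ Finset.range M, A * c * P (blk x) * q ^ (N + m) * Real.exp (-((1 - α) * δ₀ * g.dist (blk x) y'))) * B
          = A * c * P (blk x) * Real.exp (-((1 - α) * δ₀ * g.dist (blk x) y')) * B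
              * ∑ m ∈ Finset.range M, q ^ (N + m) := by
            rw [Finset.sum_mul, Finset.mul_sum]
            exact Finset.sum_congr rfl fun m _ => by ring
        _ ≤ A * c * P (blk x) * Real.exp (-((1 - α) * δ₀ * g.dist (blk x) y')) * B * (q ^ N * (1 - q)⁻¹) :=
            mul_le_mul_of_nonneg_left hgeom hK0
        _ = C := by rw [hC]; ring
    nlinarith [hrem, h1]
  have hlim : Filter.Tendsto (fun M : ℕ => C + E * B * q ^ (N + M)) Filter.atTop (nhds (C + E * B * 0)) := by
    have h0 : Filter.Tendsto (fun M : ℕ => q ^ (N + M)) Filter.atTop (nhds 0) := by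
      have h := (tendsto_pow_atTop_nhds_zero_of_lt_one hq0 hsmall).const_mul (q ^ N)
      rw [mul_zero] at h
      refine h.congr fun M => ?_
      rw [pow_add]
    exact (h0.const_mul (E * B)).const_add C
  rw [mul_zero, add_zero] at hlim
  have := ge_of_tendsto' hlim hM
  simpa [hC, hq] using this

end Generic

/-! ## §2 The genuine `k`-level operator: the remainders of (2.50) in the norms of the first two entries -/

section KLevel

variable {ℓ Mh k R : ℕ} {P : Fin (d + 1) → ℕ}

/-- **(2.50) FOR THE GENUINE `k`-LEVEL OPERATOR, PARTIAL SUMS AND REMAINDER**: `G′ = G′₀Σ_{n<N}Rⁿ + G′R^N` as matrices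
(`G′ = gml`, `G′₀ = gZeroML`, `R = rML`). [cite: Balaban1984PropagatorsII, (2.50) p.232, (2.38) p.229] -/
theorem gml_eq_partialSum_add_remainder (D : Domains d ℓ Mh k P R) {a c : ℕ → ℝ} (hℓ : 1 ≤ ℓ) (hR : 2 * (ℓ + 1) ≤ R)
    (hP : ∀ μ, 1 ≤ P μ) (hMh : 1 ≤ Mh) (ha : ∀ i, 1 ≤ i → 0 < a i) (hcpos : ∀ i, 1 ≤ i → 0 < c i)
    (hac : ∀ i, 1 ≤ i → a (i + 1) = aNext ℓ (a i) (c i)) (N : ℕ) :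
    gml (N0 ℓ Mh k P) ℓ k D.lev a
      = gZeroML D a c hP * (∑ n ∈ Finset.range N, rML D a c hP ^ n) + gml (N0 ℓ Mh k P) ℓ k D.lev a * rML D a c hP ^ N := by
  have hfix := fixedPoint_gml D (c := c) hℓ hR hP hMh ha hcpos hac
  have h := partialSum_add_remainder hfix N
  apply Matrix.toLin'.injective
  rw [h, map_add, Matrix.toLin'_mul, Matrix.toLin'_mul, Matrix.toLin'_pow, map_sum]
  simp only [Matrix.toLin'_pow, Module.End.mul_eq_comp]

/-- **[B6] PROPOSITION 2.2, CONVERGENCE CLAUSE, FIRST ENTRY, GENUINE `k`-LEVEL OPERATOR**: there are `δ₀, C, M₀ > 0`,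
`N₀ ≥ 1` (functions of `d`, `ℓ`, the windows) such that for every `k`, `M_h ≥ 3` with `L·M_h ≥ M₀`, `R ≥ 2L` with
`RM ≥ N₀ + 1`, volume, nested family `D` (2.1)–(2.2), weights in the windows with `a_{i+1} = aNext ℓ a_i c_i`, and EVERY `N`:
the operator `G′ = Δ′_a^{−1}` has majorant `C·L^{2j}·e^{−½δ₀d(y,y′)}` on the blocks AND the remainder `G′R^N = G′ − G′₀Σ_{n<N}Rⁿ`
of the random walk representation (2.50) has majorant `C·2^{−N}·L^{2j}·e^{−½δ₀d(y,y′)}` — the partial sums of (2.50)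
converge to `G′` geometrically in the norm of the first entry of (2.67) (majorants of `R` (2.64) and `G′₀`, Lemma 2.1 on
the box, §1 with `α′ = ½`, `θc ≤ ½` from «M sufficiently large»).
[cite: Balaban1984PropagatorsII, Proposition 2.2 p.234 («The random walk representation (2.50) is convergent in the norms defined by these inequalities»), (2.50) p.232, (2.64)–(2.66) p.234] -/
theorem prop22_series_first_multiLevelBox (d ℓ : ℕ) (hℓ : 1 ≤ ℓ) (aminus aplus a2minus a2plus : ℝ) (ha : 0 < aminus)
    (ha2 : 0 < a2minus) :
    ∃ δ₀ C M₀ : ℝ, ∃ N₀ : ℕ, 0 < δ₀ ∧ 0 < C ∧ 0 < M₀ ∧ 0 < N₀ ∧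
      ∀ (k Mh R : ℕ), 3 ≤ Mh → M₀ ≤ ((ℓ : ℝ) + 1) * Mh → 2 * (ℓ + 1) ≤ R → N₀ + 1 ≤ R * ((ℓ + 1) * Mh) →
      ∀ (P : Fin (d + 1) → ℕ) (hP : ∀ μ, 1 ≤ P μ) (D : Domains d ℓ Mh k P R) (a c : ℕ → ℝ),
        (∀ i, 1 ≤ i → aminus ≤ a i ∧ a i ≤ aplus) → (∀ i, 1 ≤ i → a2minus ≤ c i ∧ c i ≤ a2plus) →
        (∀ i, 1 ≤ i → a (i + 1) = aNext ℓ (a i) (c i)) → ∀ N : ℕ,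
        HasMajorant (g := geom D) (blkOf D) (Matrix.toLin' (gml (N0 ℓ Mh k P) ℓ k D.lev a))
            (fun y y' => C * ((ℓ : ℝ) + 1) ^ (2 * y.1.1) * Real.exp (-(δ₀ / 2 * (geom D).dist y y')))
          ∧ HasMajorant (g := geom D) (blkOf D)
            (Matrix.toLin' (gml (N0 ℓ Mh k P) ℓ k D.lev a * rML D a c hP ^ N))
            (fun y y' => C * (1 / 2) ^ N * ((ℓ : ℝ) + 1) ^ (2 * y.1.1) * Real.exp (-(δ₀ / 2 * (geom D).dist y y'))) := by
  obtain ⟨δ₁, K, hδ₁, hK, hRmaj⟩ := rML_majorant d ℓ hℓ aminus aplus a2minus a2plus ha ha2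
  obtain ⟨δ₂, A, hδ₂, hA, hGmaj⟩ := gZeroML_majorant d ℓ hℓ aminus aplus a2minus a2plus ha ha2
  have hL0 : (0 : ℝ) < (ℓ : ℝ) + 1 := by positivity
  have hL1 : (1 : ℝ) ≤ (ℓ : ℝ) + 1 := by linarith [(Nat.cast_nonneg ℓ : (0 : ℝ) ≤ ℓ)]
  -- the rate `δ₀ = min(δ₁, δ₂)/(d+1)` and the (2.59)-threshold `N₀`
  set δ₀ : ℝ := min δ₁ δ₂ / (d + 1) with hδ₀
  have hδ₀pos : 0 < δ₀ := by rw [hδ₀]; exact div_pos (lt_min hδ₁ hδ₂) (by positivity)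
  set N₀ : ℕ := ⌈4 * ((d : ℝ) + 1) * ((ℓ : ℝ) + 1) / (1 / 2 * δ₀)⌉₊ + 1 with hN₀
  have hN₀pos : 0 < N₀ := by rw [hN₀]; omega
  have hθlt : Real.exp (-(1 / 2 * δ₀)) * ((ℓ : ℝ) + 1) ^ ((2 * (d + 1 : ℕ) : ℝ) / N₀) < 1 := by
    refine theta_lt_one_of_log hL0 hN₀pos ?_
    have hlog : Real.log ((ℓ : ℝ) + 1) ≤ (ℓ : ℝ) + 1 := (Real.log_le_sub_one_of_pos hL0).trans (by linarith)
    have hN₀ge : 4 * ((d : ℝ) + 1) * ((ℓ : ℝ) + 1) / (1 / 2 * δ₀) < (N₀ : ℝ) := by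
      rw [hN₀]; push_cast
      exact lt_of_le_of_lt (Nat.le_ceil _) (by linarith)
    have hσ : (0 : ℝ) < 1 / 2 * δ₀ := by positivity
    rw [div_lt_iff₀ hσ] at hN₀ge
    push_cast
    nlinarith [mul_nonneg (by positivity : (0 : ℝ) ≤ 2 * ((d : ℝ) + 1)) (Real.log_nonneg hL1)]
  -- the (2.61)-constant and «M sufficiently large»
  set cK : ℝ := K261 N₀ (d + 1) ((ℓ : ℝ) + 1) 1 (1 / 2 * δ₀) with hcK
  have hcK0 : 0 ≤ cK := K261_nonneg (by positivity) zero_le_one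
  set M₀ : ℝ := 2 * K * cK + 1 with hM₀
  refine ⟨δ₀, 2 * A * cK + 1, M₀, N₀, hδ₀pos, by positivity, by positivity, hN₀pos, ?_⟩
  intro k Mh R hMh hM hR hRM P hP D a c haw hcw hac N
  have hMh1 : 1 ≤ Mh := le_trans (by norm_num) hMh
  have hMpos : (0 : ℝ) < ((ℓ : ℝ) + 1) * Mh := by
    have : (1 : ℝ) ≤ Mh := by exact_mod_cast hMh1
    positivity
  -- the majorants of `R` and `G′₀`, at the common rate `δ₀`
  set θ : ℝ := K / (((ℓ : ℝ) + 1) * Mh) with hθ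
  have hθ0 : 0 ≤ θ := by positivity
  have hdnn : ∀ y y' : (geom D).Site, 0 ≤ (geom D).dist y y' := (triangle_refl_nonneg D hMh1 hP).2.2
  have hrate : ∀ (δ : ℝ), min δ₁ δ₂ ≤ δ → ∀ y y' : (geom D).Site,
      Real.exp (-(δ / (d + 1) * (geom D).dist y y')) ≤ Real.exp (-(δ₀ * (geom D).dist y y')) := by
    intro δ hδ y y'
    rw [Real.exp_le_exp, hδ₀, neg_le_neg_iff]
    exact mul_le_mul_of_nonneg_right (div_le_div_of_nonneg_right hδ (by positivity)) (hdnn y y')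
  have hRm : HasMajorant (g := geom D) (blkOf D) (Matrix.toLin' (rML D a c hP))
      (fun y y' => θ * Real.exp (-(δ₀ * (geom D).dist y y'))) :=
    hasMajorant_mono (blkOf D) (hRmaj k Mh R hMh hR P hP D a c haw hcw) fun y y' =>
      mul_le_mul_of_nonneg_left (hrate δ₁ (min_le_left _ _) y y') hθ0
  have hGm : HasMajorant (g := geom D) (blkOf D) (Matrix.toLin' (gZeroML D a c hP))
      (fun y y' => A * ((ℓ : ℝ) + 1) ^ (2 * y.1.1) * Real.exp (-(δ₀ * (geom D).dist y y'))) :=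
    hasMajorant_mono (blkOf D) (hGmaj k Mh R hMh hR P hP D a c haw hcw) fun y y' =>
      mul_le_mul_of_nonneg_left (hrate δ₂ (min_le_right _ _) y y') (by positivity)
  -- Lemma 2.1 on the box with `α = ½`
  obtain ⟨-, h261, -, h263⟩ := lemma21_box D hMh1 hP hN₀pos hRM hδ₀pos.le (α := 1 / 2) (by norm_num)
    (by norm_num) hθlt
  obtain ⟨htri, hrefl, -⟩ := triangle_refl_nonneg D hMh1 hP
  -- the smallness `θ·c ≤ ½` from `M ≥ M₀`
  have hsmall : θ * cK ≤ 1 / 2 := by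
    rw [hθ, div_mul_eq_mul_div, div_le_iff₀ hMpos]
    have : 2 * K * cK + 1 ≤ ((ℓ : ℝ) + 1) * Mh := hM
    nlinarith
  have hsmall' : θ * cK < 1 := by linarith
  have hq0 : 0 ≤ θ * cK := mul_nonneg hθ0 hcK0
  have hinv : (1 - θ * cK)⁻¹ ≤ 2 := by
    rw [inv_le_comm₀ (by linarith) (by norm_num)]; linarith
  -- the fixed point, the chain and its tail
  have hfix := fixedPoint_gml D (c := c) hℓ hR hP hMh1 (fun i hi => lt_of_lt_of_le ha (haw i hi).1)
    (fun i hi => lt_of_lt_of_le ha2 (hcw i hi).1) hac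
  have hchain := majorant_of_fixedPoint_266W (g := geom D) (blkOf D) cK δ₀ (1 / 2) θ A
    (fun y => ((ℓ : ℝ) + 1) ^ (2 * y.1.1)) hA.le (fun y => by positivity) hθ0 hcK0
    (by nlinarith [hδ₀pos.le] : (0 : ℝ) ≤ (1 - 1 / 2) * δ₀) htri hrefl hdnn h261 h263 hsmall' hGm hRm hfix
  have htail := majorant_remainder_266W (g := geom D) (blkOf D) cK δ₀ (1 / 2) θ A
    (fun y => ((ℓ : ℝ) + 1) ^ (2 * y.1.1)) hA.le (fun y => by positivity) hθ0 hcK0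
    (by nlinarith [hδ₀pos.le] : (0 : ℝ) ≤ (1 - 1 / 2) * δ₀) htri hrefl hdnn h261 h263 hsmall' hGm hRm hfix N
  have hrate2 : ∀ y y' : (geom D).Site,
      Real.exp (-((1 - 1 / 2) * δ₀ * (geom D).dist y y')) = Real.exp (-(δ₀ / 2 * (geom D).dist y y')) := by
    intro y y'; congr 1; ring
  have h1 : A * cK * (1 - θ * cK)⁻¹ ≤ 2 * A * cK + 1 := by
    have : A * cK * (1 - θ * cK)⁻¹ ≤ A * cK * 2 := mul_le_mul_of_nonneg_left hinv (by positivity)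
    linarith
  refine ⟨?_, ?_⟩
  · refine hasMajorant_mono (g := geom D) (blkOf D) hchain fun y y' => ?_
    rw [← hrate2]
    have hP0 : 0 ≤ ((ℓ : ℝ) + 1) ^ (2 * y.1.1) * Real.exp (-((1 - 1 / 2) * δ₀ * (geom D).dist y y')) := by positivity
    calc A * cK * (1 - θ * cK)⁻¹ * ((ℓ : ℝ) + 1) ^ (2 * y.1.1) * Real.exp (-((1 - 1 / 2) * δ₀ * (geom D).dist y y'))
        = A * cK * (1 - θ * cK)⁻¹ * (((ℓ : ℝ) + 1) ^ (2 * y.1.1) * Real.exp (-((1 - 1 / 2) * δ₀ * (geom D).dist y y'))) := by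
          ring
      _ ≤ (2 * A * cK + 1) * (((ℓ : ℝ) + 1) ^ (2 * y.1.1) * Real.exp (-((1 - 1 / 2) * δ₀ * (geom D).dist y y'))) :=
          mul_le_mul_of_nonneg_right h1 hP0
      _ = _ := by ring
  · rw [Matrix.toLin'_mul, Matrix.toLin'_pow, ← Module.End.mul_eq_comp]
    refine hasMajorant_mono (g := geom D) (blkOf D) htail fun y y' => ?_
    rw [← hrate2]
    have hP0 : 0 ≤ ((ℓ : ℝ) + 1) ^ (2 * y.1.1) * Real.exp (-((1 - 1 / 2) * δ₀ * (geom D).dist y y')) := by positivity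
    -- `(θc)^N ≤ (½)^N`
    have hpow : (θ * cK) ^ N ≤ (1 / 2) ^ N := pow_le_pow_left₀ hq0 hsmall N
    have hpow0 : 0 ≤ (θ * cK) ^ N := pow_nonneg hq0 N
    have h2 : A * cK * (θ * cK) ^ N * (1 - θ * cK)⁻¹ ≤ (2 * A * cK + 1) * (1 / 2) ^ N := by
      calc A * cK * (θ * cK) ^ N * (1 - θ * cK)⁻¹ = (A * cK * (1 - θ * cK)⁻¹) * (θ * cK) ^ N := by ring
        _ ≤ (2 * A * cK + 1) * (1 / 2) ^ N := mul_le_mul h1 hpow hpow0 (by positivity)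
    calc A * cK * (θ * cK) ^ N * (1 - θ * cK)⁻¹ * ((ℓ : ℝ) + 1) ^ (2 * y.1.1)
          * Real.exp (-((1 - 1 / 2) * δ₀ * (geom D).dist y y'))
        = A * cK * (θ * cK) ^ N * (1 - θ * cK)⁻¹
          * (((ℓ : ℝ) + 1) ^ (2 * y.1.1) * Real.exp (-((1 - 1 / 2) * δ₀ * (geom D).dist y y'))) := by ring
      _ ≤ (2 * A * cK + 1) * (1 / 2) ^ N
          * (((ℓ : ℝ) + 1) ^ (2 * y.1.1) * Real.exp (-((1 - 1 / 2) * δ₀ * (geom D).dist y y'))) :=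
          mul_le_mul_of_nonneg_right h2 hP0
      _ = _ := by ring

/-- **[B6] PROPOSITION 2.2, CONVERGENCE CLAUSE, SECOND ENTRY (`∇_μG′`), GENUINE `k`-LEVEL OPERATOR**: same quantifiers;
for every axis `μ` and every `N`, `∇_μG′` has majorant `C·L^{j}·e^{−½δ₀d}` and the remainder `∇_μG′R^N = ∇_μ(G′ − G′₀Σ_{n<N}Rⁿ)`
has majorant `C·2^{−N}·L^{j}·e^{−½δ₀d}` (fixed point `∇G′ = ∇G′₀ + (∇G′)R` of file 6, majorant of `∇G′₀`, §1).
[cite: Balaban1984PropagatorsII, Proposition 2.2 p.234 («(2.50) is convergent in the norms defined by these inequalities»), (2.50) p.232, (2.64)–(2.67) p.234] -/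
theorem prop22_series_second_multiLevelBox (d ℓ : ℕ) (hℓ : 1 ≤ ℓ) (aminus aplus a2minus a2plus : ℝ)
    (ha : 0 < aminus) (ha2 : 0 < a2minus) :
    ∃ δ₀ C M₀ : ℝ, ∃ N₀ : ℕ, 0 < δ₀ ∧ 0 < C ∧ 0 < M₀ ∧ 0 < N₀ ∧
      ∀ (k Mh R : ℕ), 3 ≤ Mh → M₀ ≤ ((ℓ : ℝ) + 1) * Mh → 2 * (ℓ + 1) ≤ R → N₀ + 1 ≤ R * ((ℓ + 1) * Mh) →
      ∀ (P : Fin (d + 1) → ℕ) (hP : ∀ μ, 1 ≤ P μ) (D : Domains d ℓ Mh k P R) (a c : ℕ → ℝ),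
        (∀ i, 1 ≤ i → aminus ≤ a i ∧ a i ≤ aplus) → (∀ i, 1 ≤ i → a2minus ≤ c i ∧ c i ≤ a2plus) →
        (∀ i, 1 ≤ i → a (i + 1) = aNext ℓ (a i) (c i)) → ∀ (μ : Fin (d + 1)) (N : ℕ),
        HasMajorant (g := geom D) (blkOf D)
            (Matrix.toLin' (dMat (N0 ℓ Mh k P) μ * gml (N0 ℓ Mh k P) ℓ k D.lev a))
            (fun y y' => C * ((ℓ : ℝ) + 1) ^ y.1.1 * Real.exp (-(δ₀ / 2 * (geom D).dist y y')))
          ∧ HasMajorant (g := geom D) (blkOf D)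
            (Matrix.toLin' (dMat (N0 ℓ Mh k P) μ * gml (N0 ℓ Mh k P) ℓ k D.lev a * rML D a c hP ^ N))
            (fun y y' => C * (1 / 2) ^ N * ((ℓ : ℝ) + 1) ^ y.1.1 * Real.exp (-(δ₀ / 2 * (geom D).dist y y'))) := by
  obtain ⟨δ₁, K, hδ₁, hK, hRmaj⟩ := rML_majorant d ℓ hℓ aminus aplus a2minus a2plus ha ha2
  obtain ⟨δ₂, A, hδ₂, hA, hGmaj⟩ := dMat_gZeroML_majorant d ℓ hℓ aminus aplus a2minus a2plus ha ha2
  have hL0 : (0 : ℝ) < (ℓ : ℝ) + 1 := by positivity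
  have hL1 : (1 : ℝ) ≤ (ℓ : ℝ) + 1 := by linarith [(Nat.cast_nonneg ℓ : (0 : ℝ) ≤ ℓ)]
  set δ₀ : ℝ := min δ₁ δ₂ / (d + 1) with hδ₀
  have hδ₀pos : 0 < δ₀ := by rw [hδ₀]; exact div_pos (lt_min hδ₁ hδ₂) (by positivity)
  set N₀ : ℕ := ⌈4 * ((d : ℝ) + 1) * ((ℓ : ℝ) + 1) / (1 / 2 * δ₀)⌉₊ + 1 with hN₀
  have hN₀pos : 0 < N₀ := by rw [hN₀]; omega
  have hθlt : Real.exp (-(1 / 2 * δ₀)) * ((ℓ : ℝ) + 1) ^ ((2 * (d + 1 : ℕ) : ℝ) / N₀) < 1 := by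
    refine theta_lt_one_of_log hL0 hN₀pos ?_
    have hlog : Real.log ((ℓ : ℝ) + 1) ≤ (ℓ : ℝ) + 1 := (Real.log_le_sub_one_of_pos hL0).trans (by linarith)
    have hN₀ge : 4 * ((d : ℝ) + 1) * ((ℓ : ℝ) + 1) / (1 / 2 * δ₀) < (N₀ : ℝ) := by
      rw [hN₀]; push_cast
      exact lt_of_le_of_lt (Nat.le_ceil _) (by linarith)
    have hσ : (0 : ℝ) < 1 / 2 * δ₀ := by positivity
    rw [div_lt_iff₀ hσ] at hN₀ge
    push_cast
    nlinarith [mul_nonneg (by positivity : (0 : ℝ) ≤ 2 * ((d : ℝ) + 1)) (Real.log_nonneg hL1)]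
  set cK : ℝ := K261 N₀ (d + 1) ((ℓ : ℝ) + 1) 1 (1 / 2 * δ₀) with hcK
  have hcK0 : 0 ≤ cK := K261_nonneg (by positivity) zero_le_one
  set M₀ : ℝ := 2 * K * cK + 1 with hM₀
  refine ⟨δ₀, 2 * A * cK + 1, M₀, N₀, hδ₀pos, by positivity, by positivity, hN₀pos, ?_⟩
  intro k Mh R hMh hM hR hRM P hP D a c haw hcw hac μ N
  have hMh1 : 1 ≤ Mh := le_trans (by norm_num) hMh
  have hMpos : (0 : ℝ) < ((ℓ : ℝ) + 1) * Mh := by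
    have : (1 : ℝ) ≤ Mh := by exact_mod_cast hMh1
    positivity
  set θ : ℝ := K / (((ℓ : ℝ) + 1) * Mh) with hθ
  have hθ0 : 0 ≤ θ := by positivity
  have hdnn : ∀ y y' : (geom D).Site, 0 ≤ (geom D).dist y y' := (triangle_refl_nonneg D hMh1 hP).2.2
  have hrate : ∀ (δ : ℝ), min δ₁ δ₂ ≤ δ → ∀ y y' : (geom D).Site,
      Real.exp (-(δ / (d + 1) * (geom D).dist y y')) ≤ Real.exp (-(δ₀ * (geom D).dist y y')) := by
    intro δ hδ y y'
    rw [Real.exp_le_exp, hδ₀, neg_le_neg_iff]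
    exact mul_le_mul_of_nonneg_right (div_le_div_of_nonneg_right hδ (by positivity)) (hdnn y y')
  have hRm : HasMajorant (g := geom D) (blkOf D) (Matrix.toLin' (rML D a c hP))
      (fun y y' => θ * Real.exp (-(δ₀ * (geom D).dist y y'))) :=
    hasMajorant_mono (blkOf D) (hRmaj k Mh R hMh hR P hP D a c haw hcw) fun y y' =>
      mul_le_mul_of_nonneg_left (hrate δ₁ (min_le_left _ _) y y') hθ0
  have hGm : HasMajorant (g := geom D) (blkOf D) (Matrix.toLin' (dMat (N0 ℓ Mh k P) μ * gZeroML D a c hP))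
      (fun y y' => A * ((ℓ : ℝ) + 1) ^ y.1.1 * Real.exp (-(δ₀ * (geom D).dist y y'))) :=
    hasMajorant_mono (blkOf D) (hGmaj k Mh R hMh hR P hP D a c haw hcw μ) fun y y' =>
      mul_le_mul_of_nonneg_left (hrate δ₂ (min_le_right _ _) y y') (by positivity)
  obtain ⟨-, h261, -, h263⟩ := lemma21_box D hMh1 hP hN₀pos hRM hδ₀pos.le (α := 1 / 2) (by norm_num)
    (by norm_num) hθlt
  obtain ⟨htri, hrefl, -⟩ := triangle_refl_nonneg D hMh1 hP
  have hsmall : θ * cK ≤ 1 / 2 := by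
    rw [hθ, div_mul_eq_mul_div, div_le_iff₀ hMpos]
    have : 2 * K * cK + 1 ≤ ((ℓ : ℝ) + 1) * Mh := hM
    nlinarith
  have hsmall' : θ * cK < 1 := by linarith
  have hq0 : 0 ≤ θ * cK := mul_nonneg hθ0 hcK0
  have hinv : (1 - θ * cK)⁻¹ ≤ 2 := by
    rw [inv_le_comm₀ (by linarith) (by norm_num)]; linarith
  have hfix := fixedPoint_dMat_gml D (c := c) hℓ hR hP hMh1 (fun i hi => lt_of_lt_of_le ha (haw i hi).1)
    (fun i hi => lt_of_lt_of_le ha2 (hcw i hi).1) hac μ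
  have hchain := majorant_of_fixedPoint_266W (g := geom D) (blkOf D) cK δ₀ (1 / 2) θ A
    (fun y => ((ℓ : ℝ) + 1) ^ y.1.1) hA.le (fun y => by positivity) hθ0 hcK0
    (by nlinarith [hδ₀pos.le] : (0 : ℝ) ≤ (1 - 1 / 2) * δ₀) htri hrefl hdnn h261 h263 hsmall' hGm hRm hfix
  have htail := majorant_remainder_266W (g := geom D) (blkOf D) cK δ₀ (1 / 2) θ A
    (fun y => ((ℓ : ℝ) + 1) ^ y.1.1) hA.le (fun y => by positivity) hθ0 hcK0
    (by nlinarith [hδ₀pos.le] : (0 : ℝ) ≤ (1 - 1 / 2) * δ₀) htri hrefl hdnn h261 h263 hsmall' hGm hRm hfix N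
  have hrate2 : ∀ y y' : (geom D).Site,
      Real.exp (-((1 - 1 / 2) * δ₀ * (geom D).dist y y')) = Real.exp (-(δ₀ / 2 * (geom D).dist y y')) := by
    intro y y'; congr 1; ring
  have h1 : A * cK * (1 - θ * cK)⁻¹ ≤ 2 * A * cK + 1 := by
    have : A * cK * (1 - θ * cK)⁻¹ ≤ A * cK * 2 := mul_le_mul_of_nonneg_left hinv (by positivity)
    linarith
  refine ⟨?_, ?_⟩
  · refine hasMajorant_mono (g := geom D) (blkOf D) hchain fun y y' => ?_
    rw [← hrate2]
    have hP0 : 0 ≤ ((ℓ : ℝ) + 1) ^ y.1.1 * Real.exp (-((1 - 1 / 2) * δ₀ * (geom D).dist y y')) := by positivity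
    calc A * cK * (1 - θ * cK)⁻¹ * ((ℓ : ℝ) + 1) ^ y.1.1 * Real.exp (-((1 - 1 / 2) * δ₀ * (geom D).dist y y'))
        = A * cK * (1 - θ * cK)⁻¹ * (((ℓ : ℝ) + 1) ^ y.1.1 * Real.exp (-((1 - 1 / 2) * δ₀ * (geom D).dist y y'))) := by
          ring
      _ ≤ (2 * A * cK + 1) * (((ℓ : ℝ) + 1) ^ y.1.1 * Real.exp (-((1 - 1 / 2) * δ₀ * (geom D).dist y y'))) :=
          mul_le_mul_of_nonneg_right h1 hP0
      _ = _ := by ring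
  · rw [Matrix.toLin'_mul, Matrix.toLin'_pow, ← Module.End.mul_eq_comp]
    refine hasMajorant_mono (g := geom D) (blkOf D) htail fun y y' => ?_
    rw [← hrate2]
    have hP0 : 0 ≤ ((ℓ : ℝ) + 1) ^ y.1.1 * Real.exp (-((1 - 1 / 2) * δ₀ * (geom D).dist y y')) := by positivity
    have hpow : (θ * cK) ^ N ≤ (1 / 2) ^ N := pow_le_pow_left₀ hq0 hsmall N
    have hpow0 : 0 ≤ (θ * cK) ^ N := pow_nonneg hq0 N
    have h2 : A * cK * (θ * cK) ^ N * (1 - θ * cK)⁻¹ ≤ (2 * A * cK + 1) * (1 / 2) ^ N := by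
      calc A * cK * (θ * cK) ^ N * (1 - θ * cK)⁻¹ = (A * cK * (1 - θ * cK)⁻¹) * (θ * cK) ^ N := by ring
        _ ≤ (2 * A * cK + 1) * (1 / 2) ^ N := mul_le_mul h1 hpow hpow0 (by positivity)
    calc A * cK * (θ * cK) ^ N * (1 - θ * cK)⁻¹ * ((ℓ : ℝ) + 1) ^ y.1.1
          * Real.exp (-((1 - 1 / 2) * δ₀ * (geom D).dist y y'))
        = A * cK * (θ * cK) ^ N * (1 - θ * cK)⁻¹
          * (((ℓ : ℝ) + 1) ^ y.1.1 * Real.exp (-((1 - 1 / 2) * δ₀ * (geom D).dist y y'))) := by ring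
      _ ≤ (2 * A * cK + 1) * (1 / 2) ^ N
          * (((ℓ : ℝ) + 1) ^ y.1.1 * Real.exp (-((1 - 1 / 2) * δ₀ * (geom D).dist y y'))) :=
          mul_le_mul_of_nonneg_right h2 hP0
      _ = _ := by ring

end KLevel

/-! ## §3 The lifted Hölder functional of the fourth entry: the remainders of (2.50), printed quantifier order -/

section Holder

variable {ℓ Mh k R : ℕ} {P : Fin (d + 1) → ℕ}

/-- the lifted pair functional of a remainder: `liftL T(M·R^N) = liftL T(M) · (liftR R)^N` (`T(M·M′) = T(M) ∘ M′`,
`liftL A · liftR R = liftL (A ∘ R)`). [cite: Balaban1984PropagatorsII, (2.50) p.232, (2.52)–(2.55) p.232, dictionary] -/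
theorem liftL_holderOp_mul_pow (D : Domains d ℓ Mh k P R) (μ : Fin (d + 1)) (α : ℝ)
    (M Rm : Matrix ↥(boxDom (N0 ℓ Mh k P)) ↥(boxDom (N0 ℓ Mh k P)) ℝ) (N : ℕ) :
    liftL (holderOp D μ α (M * Rm ^ N))
      = liftL (holderOp D μ α M) * (liftR (Y := HPair D μ) (Matrix.toLin' Rm)) ^ N := by
  induction N with
  | zero => rw [pow_zero, Matrix.mul_one, pow_zero, mul_one]
  | succ N ih => rw [pow_succ, ← Matrix.mul_assoc, holderOp_mul, ← liftL_mul_liftR, ih, pow_succ, mul_assoc]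

/-- **[B6] PROPOSITION 2.2, CONVERGENCE CLAUSE, FOURTH ENTRY (`‖ζ∇_μG′λ‖_α`), GENUINE `k`-LEVEL OPERATOR, PRINTED
QUANTIFIER ORDER**: there are `δ₀, M₀ > 0`, `N₀ ≥ 1` such that for every `0 ≤ α < 1` there is `C = C(α) > 0` with, for
every `k`, `M_h ≥ 3`, `L·M_h ≥ M₀`, `R ≥ 2L`, `RM ≥ N₀ + 1`, volume, nested family, weights in the windows
(`a_{i+1} = aNext ℓ a_i c_i`), axis `μ` and EVERY `N`: the lifted pair functional of `∇_μG′` has majorant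
`C·(L^{j})^{1−α}·e^{−½δ₀d}` on `pairs ⊕ sites` AND that of the remainder `∇_μ(G′R^N) = ∇_μ(G′ − G′₀Σ_{n<N}Rⁿ)` has majorant
`C·2^{−N}·(L^{j})^{1−α}·e^{−½δ₀d}` — the Hölder norm of a derivative of the partial sums of (2.50) converges geometrically (the
lifted fixed point of file 11, §1 on `pairs ⊕ sites`, `liftL_holderOp_mul_pow`).
[cite: Balaban1984PropagatorsII, Proposition 2.2 p.234 («(2.50) is convergent in the norms defined by these inequalities»; fourth entry «(L^jη)^{1−α}(‖ζ‖_α + |ζ|)»), (2.50) p.232, (2.64)–(2.66) p.234; Balaban1983RegularityDecay, Theorem (1.9) p.573] -/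
theorem prop22_series_fourth_multiLevelBox_unif (d ℓ : ℕ) (hℓ : 1 ≤ ℓ) (aminus aplus a2minus a2plus : ℝ)
    (ha : 0 < aminus) (ha2 : 0 < a2minus) :
    ∃ δ₀ M₀ : ℝ, ∃ N₀ : ℕ, 0 < δ₀ ∧ 0 < M₀ ∧ 0 < N₀ ∧ ∀ (α : ℝ), 0 ≤ α → α < 1 → ∃ C : ℝ, 0 < C ∧
      ∀ (k Mh R : ℕ), 3 ≤ Mh → M₀ ≤ ((ℓ : ℝ) + 1) * Mh → 2 * (ℓ + 1) ≤ R → N₀ + 1 ≤ R * ((ℓ + 1) * Mh) →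
      ∀ (P : Fin (d + 1) → ℕ) (hP : ∀ μ, 1 ≤ P μ) (D : Domains d ℓ Mh k P R) (a c : ℕ → ℝ),
        (∀ i, 1 ≤ i → aminus ≤ a i ∧ a i ≤ aplus) → (∀ i, 1 ≤ i → a2minus ≤ c i ∧ c i ≤ a2plus) →
        (∀ i, 1 ≤ i → a (i + 1) = aNext ℓ (a i) (c i)) → ∀ (μ : Fin (d + 1)) (N : ℕ),
        HasMajorant (g := geom D) (Sum.elim (blkP D μ) (blkOf D))
            (liftL (holderOp D μ α (gml (N0 ℓ Mh k P) ℓ k D.lev a)))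
            (fun y y' => C * (((ℓ : ℝ) + 1) ^ y.1.1) ^ (1 - α) * Real.exp (-(δ₀ / 2 * (geom D).dist y y')))
          ∧ HasMajorant (g := geom D) (Sum.elim (blkP D μ) (blkOf D))
            (liftL (holderOp D μ α (gml (N0 ℓ Mh k P) ℓ k D.lev a * rML D a c hP ^ N)))
            (fun y y' => C * (1 / 2) ^ N * (((ℓ : ℝ) + 1) ^ y.1.1) ^ (1 - α)
              * Real.exp (-(δ₀ / 2 * (geom D).dist y y'))) := by
  obtain ⟨δ₁, K, hδ₁, hK, hRmaj⟩ := rML_majorant d ℓ hℓ aminus aplus a2minus a2plus ha ha2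
  obtain ⟨δ₂, hδ₂, hGrowA⟩ := holderZero_rowBound_unif d ℓ hℓ aminus aplus a2minus a2plus ha ha2
  have hL0 : (0 : ℝ) < (ℓ : ℝ) + 1 := by positivity
  have hL1 : (1 : ℝ) ≤ (ℓ : ℝ) + 1 := by linarith [(Nat.cast_nonneg ℓ : (0 : ℝ) ≤ ℓ)]
  set δ₀ : ℝ := min δ₁ δ₂ / (d + 1) with hδ₀
  have hδ₀pos : 0 < δ₀ := by rw [hδ₀]; exact div_pos (lt_min hδ₁ hδ₂) (by positivity)
  set N₀ : ℕ := ⌈4 * ((d : ℝ) + 1) * ((ℓ : ℝ) + 1) / (1 / 2 * δ₀)⌉₊ + 1 with hN₀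
  have hN₀pos : 0 < N₀ := by rw [hN₀]; omega
  have hθlt : Real.exp (-(1 / 2 * δ₀)) * ((ℓ : ℝ) + 1) ^ ((2 * (d + 1 : ℕ) : ℝ) / N₀) < 1 := by
    refine theta_lt_one_of_log hL0 hN₀pos ?_
    have hlog : Real.log ((ℓ : ℝ) + 1) ≤ (ℓ : ℝ) + 1 := (Real.log_le_sub_one_of_pos hL0).trans (by linarith)
    have hN₀ge : 4 * ((d : ℝ) + 1) * ((ℓ : ℝ) + 1) / (1 / 2 * δ₀) < (N₀ : ℝ) := by
      rw [hN₀]; push_cast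
      exact lt_of_le_of_lt (Nat.le_ceil _) (by linarith)
    have hσ : (0 : ℝ) < 1 / 2 * δ₀ := by positivity
    rw [div_lt_iff₀ hσ] at hN₀ge
    push_cast
    nlinarith [mul_nonneg (by positivity : (0 : ℝ) ≤ 2 * ((d : ℝ) + 1)) (Real.log_nonneg hL1)]
  set cK : ℝ := K261 N₀ (d + 1) ((ℓ : ℝ) + 1) 1 (1 / 2 * δ₀) with hcK
  have hcK0 : 0 ≤ cK := K261_nonneg (by positivity) zero_le_one
  set M₀ : ℝ := 2 * K * cK + 1 with hM₀
  refine ⟨δ₀, M₀, N₀, hδ₀pos, by positivity, hN₀pos, fun α hα0 hα1 => ?_⟩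
  obtain ⟨A, hA, hGrow⟩ := hGrowA α hα0 hα1
  refine ⟨2 * A * cK + 1, by positivity, ?_⟩
  intro k Mh R hMh hM hR hRM P hP D a c haw hcw hac μ N
  have hMh1 : 1 ≤ Mh := le_trans (by norm_num) hMh
  have hMpos : (0 : ℝ) < ((ℓ : ℝ) + 1) * Mh := by
    have : (1 : ℝ) ≤ Mh := by exact_mod_cast hMh1
    positivity
  set θ : ℝ := K / (((ℓ : ℝ) + 1) * Mh) with hθ
  have hθ0 : 0 ≤ θ := by positivity
  have hdnn : ∀ y y' : (geom D).Site, 0 ≤ (geom D).dist y y' := (triangle_refl_nonneg D hMh1 hP).2.2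
  have hrate : ∀ (δ : ℝ), min δ₁ δ₂ ≤ δ → ∀ y y' : (geom D).Site,
      Real.exp (-(δ / (d + 1) * (geom D).dist y y')) ≤ Real.exp (-(δ₀ * (geom D).dist y y')) := by
    intro δ hδ y y'
    rw [Real.exp_le_exp, hδ₀, neg_le_neg_iff]
    exact mul_le_mul_of_nonneg_right (div_le_div_of_nonneg_right hδ (by positivity)) (hdnn y y')
  have hRm0 : HasMajorant (g := geom D) (blkOf D) (Matrix.toLin' (rML D a c hP))
      (fun y y' => θ * Real.exp (-(δ₀ * (geom D).dist y y'))) :=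
    hasMajorant_mono (blkOf D) (hRmaj k Mh R hMh hR P hP D a c haw hcw) fun y y' =>
      mul_le_mul_of_nonneg_left (hrate δ₁ (min_le_left _ _) y y') hθ0
  have hRm : HasMajorant (g := geom D) (Sum.elim (blkP D μ) (blkOf D))
      (liftR (Y := HPair D μ) (Matrix.toLin' (rML D a c hP)))
      (fun y y' => θ * Real.exp (-(δ₀ * (geom D).dist y y'))) :=
    hasMajorant_liftR (g := geom D) (blkOf D) (blkP D μ) (K := fun y y' => θ * Real.exp (-(δ₀ * (geom D).dist y y')))
      (fun y y' => by positivity) hRm0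
  have hGm : HasMajorant (g := geom D) (Sum.elim (blkP D μ) (blkOf D))
      (liftL (holderOp D μ α (gZeroML D a c hP)))
      (fun y y' => A * (((ℓ : ℝ) + 1) ^ y.1.1) ^ (1 - α) * Real.exp (-(δ₀ * (geom D).dist y y'))) := by
    refine hasMajorant_liftL (g := geom D) (blkOf D) (blkP D μ)
      (K := fun y y' => A * (((ℓ : ℝ) + 1) ^ y.1.1) ^ (1 - α) * Real.exp (-(δ₀ * (geom D).dist y y')))
      (fun y y' => by positivity) fun y' lam B hlam p => ?_
    refine (hGrow k Mh R hMh hR P hP D a c haw hcw μ y' lam B hlam p).trans ?_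
    refine mul_le_mul_of_nonneg_right ?_ hlam.nonneg
    exact mul_le_mul_of_nonneg_left (hrate δ₂ (min_le_right _ _) _ _) (by positivity)
  obtain ⟨-, h261, -, h263⟩ := lemma21_box D hMh1 hP hN₀pos hRM hδ₀pos.le (α := 1 / 2) (by norm_num)
    (by norm_num) hθlt
  obtain ⟨htri, hrefl, -⟩ := triangle_refl_nonneg D hMh1 hP
  have hsmall : θ * cK ≤ 1 / 2 := by
    rw [hθ, div_mul_eq_mul_div, div_le_iff₀ hMpos]
    have : 2 * K * cK + 1 ≤ ((ℓ : ℝ) + 1) * Mh := hM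
    nlinarith
  have hsmall' : θ * cK < 1 := by linarith
  have hq0 : 0 ≤ θ * cK := mul_nonneg hθ0 hcK0
  have hinv : (1 - θ * cK)⁻¹ ≤ 2 := by
    rw [inv_le_comm₀ (by linarith) (by norm_num)]; linarith
  have hfix := fixedPoint_holder D (c := c) hℓ hR hP hMh1 (fun i hi => lt_of_lt_of_le ha (haw i hi).1)
    (fun i hi => lt_of_lt_of_le ha2 (hcw i hi).1) hac μ α
  have hchain := majorant_of_fixedPoint_266W (g := geom D) (Sum.elim (blkP D μ) (blkOf D)) cK δ₀ (1 / 2) θ A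
    (fun y => (((ℓ : ℝ) + 1) ^ y.1.1) ^ (1 - α)) hA.le (fun y => Real.rpow_nonneg (by positivity) _) hθ0 hcK0
    (by nlinarith [hδ₀pos.le] : (0 : ℝ) ≤ (1 - 1 / 2) * δ₀) htri hrefl hdnn h261 h263 hsmall' hGm hRm hfix
  have htail := majorant_remainder_266W (g := geom D) (Sum.elim (blkP D μ) (blkOf D)) cK δ₀ (1 / 2) θ A
    (fun y => (((ℓ : ℝ) + 1) ^ y.1.1) ^ (1 - α)) hA.le (fun y => Real.rpow_nonneg (by positivity) _) hθ0 hcK0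
    (by nlinarith [hδ₀pos.le] : (0 : ℝ) ≤ (1 - 1 / 2) * δ₀) htri hrefl hdnn h261 h263 hsmall' hGm hRm hfix N
  have hrate2 : ∀ y y' : (geom D).Site,
      Real.exp (-((1 - 1 / 2) * δ₀ * (geom D).dist y y')) = Real.exp (-(δ₀ / 2 * (geom D).dist y y')) := by
    intro y y'; congr 1; ring
  have h1 : A * cK * (1 - θ * cK)⁻¹ ≤ 2 * A * cK + 1 := by
    have : A * cK * (1 - θ * cK)⁻¹ ≤ A * cK * 2 := mul_le_mul_of_nonneg_left hinv (by positivity)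
    linarith
  refine ⟨?_, ?_⟩
  · refine hasMajorant_mono (g := geom D) (Sum.elim (blkP D μ) (blkOf D)) hchain fun y y' => ?_
    rw [← hrate2]
    have hP0 : 0 ≤ (((ℓ : ℝ) + 1) ^ y.1.1) ^ (1 - α) * Real.exp (-((1 - 1 / 2) * δ₀ * (geom D).dist y y')) :=
      mul_nonneg (Real.rpow_nonneg (by positivity) _) (Real.exp_pos _).le
    calc A * cK * (1 - θ * cK)⁻¹ * (((ℓ : ℝ) + 1) ^ y.1.1) ^ (1 - α) * Real.exp (-((1 - 1 / 2) * δ₀ * (geom D).dist y y'))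
        = A * cK * (1 - θ * cK)⁻¹
          * ((((ℓ : ℝ) + 1) ^ y.1.1) ^ (1 - α) * Real.exp (-((1 - 1 / 2) * δ₀ * (geom D).dist y y'))) := by ring
      _ ≤ (2 * A * cK + 1) * ((((ℓ : ℝ) + 1) ^ y.1.1) ^ (1 - α) * Real.exp (-((1 - 1 / 2) * δ₀ * (geom D).dist y y'))) :=
          mul_le_mul_of_nonneg_right h1 hP0
      _ = _ := by ring
  · rw [liftL_holderOp_mul_pow]
    refine hasMajorant_mono (g := geom D) (Sum.elim (blkP D μ) (blkOf D)) htail fun y y' => ?_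
    rw [← hrate2]
    have hP0 : 0 ≤ (((ℓ : ℝ) + 1) ^ y.1.1) ^ (1 - α) * Real.exp (-((1 - 1 / 2) * δ₀ * (geom D).dist y y')) :=
      mul_nonneg (Real.rpow_nonneg (by positivity) _) (Real.exp_pos _).le
    have hpow : (θ * cK) ^ N ≤ (1 / 2) ^ N := pow_le_pow_left₀ hq0 hsmall N
    have hpow0 : 0 ≤ (θ * cK) ^ N := pow_nonneg hq0 N
    have h2 : A * cK * (θ * cK) ^ N * (1 - θ * cK)⁻¹ ≤ (2 * A * cK + 1) * (1 / 2) ^ N := by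
      calc A * cK * (θ * cK) ^ N * (1 - θ * cK)⁻¹ = (A * cK * (1 - θ * cK)⁻¹) * (θ * cK) ^ N := by ring
        _ ≤ (2 * A * cK + 1) * (1 / 2) ^ N := mul_le_mul h1 hpow hpow0 (by positivity)
    calc A * cK * (θ * cK) ^ N * (1 - θ * cK)⁻¹ * (((ℓ : ℝ) + 1) ^ y.1.1) ^ (1 - α)
          * Real.exp (-((1 - 1 / 2) * δ₀ * (geom D).dist y y'))
        = A * cK * (θ * cK) ^ N * (1 - θ * cK)⁻¹
          * ((((ℓ : ℝ) + 1) ^ y.1.1) ^ (1 - α) * Real.exp (-((1 - 1 / 2) * δ₀ * (geom D).dist y y'))) := by ring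
      _ ≤ (2 * A * cK + 1) * (1 / 2) ^ N
          * ((((ℓ : ℝ) + 1) ^ y.1.1) ^ (1 - α) * Real.exp (-((1 - 1 / 2) * δ₀ * (geom D).dist y y'))) :=
          mul_le_mul_of_nonneg_right h2 hP0
      _ = _ := by ring

/-- **THE HÖLDER REMAINDER READ BACK ON THE PAIRS** (same constants): for all `x ≠ x′` of one block `B^j(y)` with
`x + e_μ`, `x′ + e_μ` in the box, `λ` supported in `B^{j′}(y′)` and every `N`, with `W_N = G′R^N = G′ − G′₀Σ_{n<N}Rⁿ`:
`|x′−x|^{−α}·|((W_Nλ)(x′+e_μ) − (W_Nλ)(x′)) − ((W_Nλ)(x+e_μ) − (W_Nλ)(x))| ≤ C·2^{−N}·(L^{j})^{1−α}·e^{−½δ₀d(y,y′)}·|λ|`.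
[cite: Balaban1984PropagatorsII, Proposition 2.2 p.234 (convergence clause, fourth entry), (2.50) p.232; Balaban1983RegularityDecay, Theorem (1.9) p.573] -/
theorem prop22_series_fourth_pointwise_multiLevelBox_unif (d ℓ : ℕ) (hℓ : 1 ≤ ℓ) (aminus aplus a2minus a2plus : ℝ)
    (ha : 0 < aminus) (ha2 : 0 < a2minus) :
    ∃ δ₀ M₀ : ℝ, ∃ N₀ : ℕ, 0 < δ₀ ∧ 0 < M₀ ∧ 0 < N₀ ∧ ∀ (α : ℝ), 0 ≤ α → α < 1 → ∃ C : ℝ, 0 < C ∧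
      ∀ (k Mh R : ℕ), 3 ≤ Mh → M₀ ≤ ((ℓ : ℝ) + 1) * Mh → 2 * (ℓ + 1) ≤ R → N₀ + 1 ≤ R * ((ℓ + 1) * Mh) →
      ∀ (P : Fin (d + 1) → ℕ) (hP : ∀ μ, 1 ≤ P μ) (D : Domains d ℓ Mh k P R) (a c : ℕ → ℝ),
        (∀ i, 1 ≤ i → aminus ≤ a i ∧ a i ≤ aplus) → (∀ i, 1 ≤ i → a2minus ≤ c i ∧ c i ≤ a2plus) →
        (∀ i, 1 ≤ i → a (i + 1) = aNext ℓ (a i) (c i)) →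
        ∀ (μ : Fin (d + 1)) (N : ℕ) (y' : ↥(bset D)) (lam : ↥(boxDom (N0 ℓ Mh k P)) → ℝ) (B : ℝ),
          BlockSupp (g := geom D) (blkOf D) lam y' B →
          ∀ (x x' : ↥(boxDom (N0 ℓ Mh k P))), x'.1 ≠ x.1 → blkOf D x' = blkOf D x →
          ∀ (hxe : x.1 + Pi.single μ 1 ∈ boxDom (N0 ℓ Mh k P)) (hxe' : x'.1 + Pi.single μ 1 ∈ boxDom (N0 ℓ Mh k P)),
            (supNorm (x'.1 - x.1)) ^ (-α)
                * |(((gml (N0 ℓ Mh k P) ℓ k D.lev a * rML D a c hP ^ N) *ᵥ lam) ⟨x'.1 + Pi.single μ 1, hxe'⟩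
                      - ((gml (N0 ℓ Mh k P) ℓ k D.lev a * rML D a c hP ^ N) *ᵥ lam) x')
                    - (((gml (N0 ℓ Mh k P) ℓ k D.lev a * rML D a c hP ^ N) *ᵥ lam) ⟨x.1 + Pi.single μ 1, hxe⟩
                      - ((gml (N0 ℓ Mh k P) ℓ k D.lev a * rML D a c hP ^ N) *ᵥ lam) x)|
              ≤ C * (1 / 2) ^ N * (((ℓ : ℝ) + 1) ^ D.lev x.1) ^ (1 - α)
                * Real.exp (-(δ₀ / 2 * (geom D).dist (blkOf D x) y')) * B := by
  obtain ⟨δ₀, M₀, N₀, hδ₀, hM₀, hN₀, hCA⟩ :=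
    prop22_series_fourth_multiLevelBox_unif d ℓ hℓ aminus aplus a2minus a2plus ha ha2
  refine ⟨δ₀, M₀, N₀, hδ₀, hM₀, hN₀, fun α hα0 hα1 => ?_⟩
  obtain ⟨C, hC, h⟩ := hCA α hα0 hα1
  refine ⟨C, hC, ?_⟩
  intro k Mh R hMh hM hR hRM P hP D a c haw hcw hac μ N y' lam B hlam x x' hne hblk hxe hxe'
  have hmaj := (h k Mh R hMh hM hR hRM P hP D a c haw hcw hac μ N).2
  have hrow := rowBound_of_hasMajorant_liftL (g := geom D) (blkOf D) (blkP D μ) hmaj y' lam B hlam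
    (⟨x, x', hne, hblk, hxe, hxe'⟩ : HPair D μ)
  rw [holderOp_apply, abs_mul, abs_of_nonneg (Real.rpow_nonneg (supNorm_nonneg _) _)] at hrow
  exact hrow

end Holder

end

end Literature.MathematicalPhysics.QuantumFieldTheory.Balaban1983to89.B6Prop22SeriesMultiLevelBox
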